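import Literature.Probability.RandomPlanarGeometry.HexSAWStripEpsWalks
import Literature.Probability.RandomPlanarGeometry.HexSAWBridgeLength
import HarnessLib

/-!
# Lateral escapes vanish when the surface-weighted bridges stay bounded: `E_{T,L}(x_c, y) → 0`
# (face Y3′ `StripELimZeroY` of the door «HEX-YC-DCS»: BBdGDCG 2014, proof of Proposition 9)

Topic `Literature/Probability/RandomPlanarGeometry` (continues `HexSAWStripEpsWalks.lean` and uses box stability of
bridges `HV.mem_bridgeLists_of_length_le`, `HV.bridgeLists_mono_L` of `HexSAWBridgeLength.lean`).
Source: N. R. Beaton, M. Bousquet-Mélou, J. de Gier, H. Duminil-Copin, A. J. Guttmann, *The critical fugacity for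
surface adsorption of self-avoiding walks on the honeycomb lattice is `1 + √2`*, Comm. Math. Phys. 326 (2014)
727–754, arXiv:1109.0358v5, proof of Proposition 9 (§4.3, p. 14): "… the generating function of
walks in the strip of height `T − 1` converges at `x_c` and `B_T(x_c; y) < ∞` by assumption; hence `E_{T,L}(x_c; y)` is
bounded by the tail of a convergent series and tends to `0` as `L → ∞`."

## What is proved (lane «pcv-sawmu», door R96′ «HEX-YC-DCS» of a-idea-1 gen 17, face Y3′ verbatim)

* `bwt`, `cx`, `bb`; `sum_filter_epsBig_le`, **`stripGFy_eps_le`** — the FINITE inequality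
  `E_{T,L}(y) ≤ Σ_{L ≤ k ≤ N} c_k x_c^k + B^{≥ L/2+1}_{T,L}(y) · Σ_{k ≤ N} c_k x_c^k + B_{T,L}(y) · Σ_{L/2 ≤ k ≤ N} c_k x_c^k`
  (`c_k = c_k(S_{T−1})`, `N = |V(S_{T,L})|`, `B^{≥ M}` = bridges with at least `M` vertices);
* `sum_range_bb_le`, `summable_bb` (the bridge series converges when `B_{T,L}(y) ≤ K` for all `L`),
  `sum_filter_bridge_le` (long bridges are bounded by its tail);
* **`StripELimZeroY`** (a-idea-1's face, Sketch_G17 l. 841, verbatim) and **`stripELimZeroY_holds`**: for `T ≥ 1`,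
  `y > 0`, if `L ↦ B_{T,L}(x_c,y)` is bounded then `E_{T,L}(x_c,y) → 0`.
-/

noncomputable section

open Finset Filter Topology Literature.Probability.LatticeModels Literature.Probability.Percolation SimpleGraph

namespace Literature.Probability.RandomPlanarGeometry.SAW.HV

variable {T L : ℕ}

/-! ### The finite inequality `E ≤ S_{≥L} + B_{≥L/2+1}·S + B·S_{≥L/2}` -/

/-- The weight of a bridge of the sub-strip: `x_c^{|p|} y^{#contacts}`. [cite: BeatonBousquetMelouDeGierDuminilCopinGuttmann2014, §4.1] -/
def bwt (T : ℕ) (y : ℝ) (p : List HV) : ℝ :=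
  hexCriticalFugacity ^ p.length * y ^ (p.filter fun v => lev v = 2 * (T : ℤ) - 1).length

/-- The strip-count series term `c_k(S_{T-1}) x_c^k`. [cite: MadrasSlade1993, §8.2] -/
def cx (T k : ℕ) : ℝ := (HexBW.stripCount (T - 1) k : ℝ) * hexCriticalFugacity ^ k

/-- The length-`m` slice of the bridge series `B_T(x_c, y) = Σ_m bb m`. [cite: BeatonBousquetMelouDeGierDuminilCopinGuttmann2014, §4.2] -/
def bb (T : ℕ) (y : ℝ) (m : ℕ) : ℝ := ∑ p ∈ (bridgeLists T m).filter (fun p => p.length = m), bwt T y p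

/-- Bridge weights are non-negative for `y ≥ 0`. [cite: BeatonBousquetMelouDeGierDuminilCopinGuttmann2014, §4.1] -/
theorem bwt_nonneg (T : ℕ) {y : ℝ} (hy : 0 ≤ y) (p : List HV) : 0 ≤ bwt T y p :=
  mul_nonneg (pow_nonneg hexCriticalFugacity_pos_lt_one.1.le _) (pow_nonneg hy _)

/-- The strip-count series has non-negative terms. [cite: MadrasSlade1993, §8.2] -/
theorem cx_nonneg (T k : ℕ) : 0 ≤ cx T k :=
  mul_nonneg (Nat.cast_nonneg _) (pow_nonneg hexCriticalFugacity_pos_lt_one.1.le _)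

/-- The bridge series has non-negative terms. [cite: BeatonBousquetMelouDeGierDuminilCopinGuttmann2014, §4.2] -/
theorem bb_nonneg (T : ℕ) {y : ℝ} (hy : 0 ≤ y) (m : ℕ) : 0 ≤ bb T y m :=
  sum_nonneg fun p _ => bwt_nonneg T hy p

/-- The strip-count series converges at `x_c` (sub-criticality of `S_{T-1}`). [cite: BeatonBousquetMelouDeGierDuminilCopinGuttmann2014, proof of Proposition 9] -/
theorem summable_cx (T : ℕ) : Summable (cx T) := summable_stripCount_mul_pow (T - 1)

/-- Splitting the «big» pairs into long-prefix and long-suffix ones and factorising.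
[cite: BeatonBousquetMelouDeGierDuminilCopinGuttmann2014, proof of Proposition 9] -/
theorem sum_filter_epsBig_le (T L N : ℕ) {y : ℝ} (hy : 0 ≤ y) :
    ∑ q ∈ (bridgeLists T L ×ˢ spTarget T N).filter (EpsBig L), pairWt T y q ≤
      (∑ p ∈ (bridgeLists T L).filter (fun p => L / 2 + 1 ≤ p.length), bwt T y p) *
          (∑ k ∈ Finset.range (N + 1), cx T k) +
        (∑ p ∈ bridgeLists T L, bwt T y p) *
          ∑ k ∈ (Finset.range (N + 1)).filter (fun k => L / 2 ≤ k), cx T k := by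
  classical
  have hx := hexCriticalFugacity_pos_lt_one
  have hnn : ∀ q : List HV × (Σ _ : ℕ, Site 2 × (ℕ → Site 2)), 0 ≤ pairWt T y q := fun q =>
    mul_nonneg (mul_nonneg (pow_nonneg hx.1.le _) (pow_nonneg hy _)) (pow_nonneg hx.1.le _)
  set A := (bridgeLists T L).filter (fun p => L / 2 + 1 ≤ p.length) ×ˢ spTarget T N
  set B := bridgeLists T L ×ˢ (spTarget T N).filter (fun σ => L / 2 ≤ σ.1)
  have hsub : (bridgeLists T L ×ˢ spTarget T N).filter (EpsBig L) ⊆ A ∪ B := by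
    intro q hq
    rw [mem_filter, mem_product, EpsBig] at hq
    rw [mem_union, mem_product, mem_product, mem_filter, mem_filter]
    tauto
  refine (sum_le_sum_of_subset_of_nonneg hsub fun q _ _ => hnn q).trans ?_
  have hAB : ∑ q ∈ A ∪ B, pairWt T y q ≤ ∑ q ∈ A, pairWt T y q + ∑ q ∈ B, pairWt T y q := by
    rw [← sum_union_inter]
    exact le_add_of_nonneg_right (sum_nonneg fun q _ => hnn q)
  refine hAB.trans (le_of_eq ?_)
  simp only [A, B, sum_product]
  rw [Finset.sum_mul_sum, Finset.sum_mul_sum]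
  refine congrArg₂ (· + ·) (sum_congr rfl fun p _ => ?_) (sum_congr rfl fun p _ => ?_)
  · simp only [pairWt]
    rw [← Finset.mul_sum, sum_spTarget, Finset.mul_sum]
    rfl
  · simp only [pairWt]
    rw [← Finset.mul_sum, sum_spTarget_filter, Finset.mul_sum]
    rfl

/-- **The finite inequality**: `E_{T,L}(y) ≤ Σ_{k ≥ L} c_k x^k + B^{≥ L/2+1}·Σ_k c_k x^k + B·Σ_{k ≥ L/2} c_k x^k`
(all `k ≤ |V(S_{T,L})|`). [cite: BeatonBousquetMelouDeGierDuminilCopinGuttmann2014, proof of Proposition 9 (§4.3, arXiv v5 p. 14)] -/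
theorem stripGFy_eps_le (hT : 1 ≤ T) {y : ℝ} (hy : 0 ≤ y) :
    stripGFy T L (IsEpsDart L) y ≤
      (∑ k ∈ (Finset.range ((stripV T L).card + 1)).filter (fun k => L ≤ k), cx T k) +
      ((∑ p ∈ (bridgeLists T L).filter (fun p => L / 2 + 1 ≤ p.length), bwt T y p) *
          (∑ k ∈ Finset.range ((stripV T L).card + 1), cx T k) +
        (∑ p ∈ bridgeLists T L, bwt T y p) *
          ∑ k ∈ (Finset.range ((stripV T L).card + 1)).filter (fun k => L / 2 ≤ k), cx T k) := by
  rw [stripGFy, ← epsWalks,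
    ← sum_filter_add_sum_filter_not (epsWalks T L) (fun P => ∀ x ∈ inner P, lev x ≠ 2 * (T : ℤ) - 1)]
  refine add_le_add (sum_eps_noContact_le hT y) ?_
  have hcongr : (epsWalks T L).filter (fun P => ¬ ∀ x ∈ inner P, lev x ≠ 2 * (T : ℤ) - 1) =
      (epsWalks T L).filter (fun P => ∃ x ∈ inner P, lev x = 2 * (T : ℤ) - 1) :=
    filter_congr fun P _ => by push Not; rfl
  rw [hcongr]
  exact (sum_eps_contact_le hT hy).trans (sum_filter_epsBig_le T L _ hy)

/-! ### Tails of the two convergent series -/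

/-- A filtered partial sum is at most the series tail. [folklore] -/
private theorem sum_range_filter_le_tsum_sub {f : ℕ → ℝ} (hf : ∀ k, 0 ≤ f k) (hs : Summable f) (n M : ℕ) :
    ∑ k ∈ (Finset.range n).filter (fun k => M ≤ k), f k ≤ ∑' k, f k - ∑ k ∈ Finset.range M, f k := by
  rw [le_sub_iff_add_le, ← sum_union]
  · exact hs.sum_le_tsum _ fun _ _ => hf _
  · exact disjoint_left.2 fun k hk hk' => by
      rw [mem_filter] at hk; rw [mem_range] at hk'; omega

/-- Partial sums of the bridge series are bounded by `B_{T,M}(y)`. [cite: BeatonBousquetMelouDeGierDuminilCopinGuttmann2014, §4.2] -/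
theorem sum_range_bb_le (hT : 1 ≤ T) {y : ℝ} (hy : 0 ≤ y) (M : ℕ) :
    ∑ m ∈ Finset.range M, bb T y m ≤ stripGFy T M (IsBetaDart T) y := by
  rw [stripGFy_beta_eq_sum_bridgeLists hT]
  change _ ≤ ∑ p ∈ bridgeLists T M, bwt T y p
  calc ∑ m ∈ Finset.range M, bb T y m
      ≤ ∑ m ∈ Finset.range M, ∑ p ∈ (bridgeLists T M).filter (fun p => p.length = m), bwt T y p :=
        sum_le_sum fun m hm => sum_le_sum_of_subset_of_nonneg
          (filter_subset_filter _ (bridgeLists_mono_L hT (mem_range.1 hm).le)) fun p _ _ => bwt_nonneg T hy p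
    _ = ∑ p ∈ bridgeLists T M, ∑ m ∈ Finset.range M, if p.length = m then bwt T y p else 0 := by
        rw [sum_comm]; simp only [sum_filter]
    _ ≤ ∑ p ∈ bridgeLists T M, bwt T y p := sum_le_sum fun p _ => by
        rw [sum_ite_eq]; split_ifs
        · exact le_rfl
        · exact bwt_nonneg T hy p

/-- The bridge series converges when `B_{T,L}(y) ≤ K` for all `L`. [cite: BeatonBousquetMelouDeGierDuminilCopinGuttmann2014, §4.2] -/
theorem summable_bb (hT : 1 ≤ T) {y K : ℝ} (hy : 0 ≤ y) (hK : ∀ L : ℕ, stripGFy T L (IsBetaDart T) y ≤ K) :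
    Summable (bb T y) :=
  summable_of_sum_range_le (fun m => bb_nonneg T hy m) fun M => (sum_range_bb_le hT hy M).trans (hK M)

/-- Long bridges of `S_{T,L}` are bounded by the tail of the bridge series. [cite: BeatonBousquetMelouDeGierDuminilCopinGuttmann2014, proof of Proposition 9] -/
theorem sum_filter_bridge_le (hT : 1 ≤ T) {y K : ℝ} (hy : 0 ≤ y) (hK : ∀ L : ℕ, stripGFy T L (IsBetaDart T) y ≤ K)
    (L M : ℕ) :
    ∑ p ∈ (bridgeLists T L).filter (fun p => M ≤ p.length), bwt T y p ≤
      ∑' m, bb T y m - ∑ m ∈ Finset.range M, bb T y m := by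
  classical
  set Big := (stripV T L).card + 1
  have hlen : ∀ p ∈ bridgeLists T L, p.length < Big := by
    intro p hp
    obtain ⟨-, -, hnd, hV, -, -⟩ := (mem_bridgeLists_iff hT).1 hp
    have : p.toFinset.card ≤ (stripV T L).card := card_le_card fun x hx => hV x (List.mem_toFinset.1 hx)
    rw [List.toFinset_card_of_nodup hnd] at this
    omega
  calc ∑ p ∈ (bridgeLists T L).filter (fun p => M ≤ p.length), bwt T y p
      ≤ ∑ p ∈ (bridgeLists T L).filter (fun p => p.length ∈ (Finset.range Big).filter (fun m => M ≤ m)), bwt T y p :=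
        sum_le_sum_of_subset_of_nonneg (fun p hp => by
          rw [mem_filter] at hp ⊢
          exact ⟨hp.1, mem_filter.2 ⟨mem_range.2 (hlen p hp.1), hp.2⟩⟩) fun p _ _ => bwt_nonneg T hy p
    _ = ∑ p ∈ bridgeLists T L, ∑ m ∈ (Finset.range Big).filter (fun m => M ≤ m),
          if p.length = m then bwt T y p else 0 := by
        rw [sum_filter]
        refine sum_congr rfl fun p _ => ?_
        rw [sum_ite_eq]
    _ = ∑ m ∈ (Finset.range Big).filter (fun m => M ≤ m), ∑ p ∈ (bridgeLists T L).filter (fun p => p.length = m),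
          bwt T y p := by
        rw [sum_comm]; simp only [sum_filter]
    _ ≤ ∑ m ∈ (Finset.range Big).filter (fun m => M ≤ m), bb T y m :=
        sum_le_sum fun m _ => sum_le_sum_of_subset_of_nonneg (fun p hp => by
          rw [mem_filter] at hp ⊢
          exact ⟨mem_bridgeLists_of_length_le hT hp.1 hp.2.le, hp.2⟩) fun p _ _ => bwt_nonneg T hy p
    _ ≤ ∑' m, bb T y m - ∑ m ∈ Finset.range M, bb T y m :=
        sum_range_filter_le_tsum_sub (fun m => bb_nonneg T hy m) (summable_bb hT hy hK) _ _

/-- Series tails tend to zero. [folklore] -/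
private theorem tendsto_tsum_sub_sum_range {f : ℕ → ℝ} (hs : Summable f) {g : ℕ → ℕ} (hg : Tendsto g atTop atTop) :
    Tendsto (fun L => ∑' k, f k - ∑ k ∈ Finset.range (g L), f k) atTop (𝓝 0) := by
  have h := (hs.hasSum.tendsto_sum_nat).comp hg
  have := tendsto_const_nhds (x := ∑' k, f k) |>.sub h
  rw [sub_self] at this
  exact this

/-- `L/2 → ∞`. [folklore] -/
private theorem tendsto_div_two : Tendsto (fun L : ℕ => L / 2) atTop atTop :=
  tendsto_atTop_atTop.2 fun b => ⟨2 * b, fun L hL => by omega⟩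

/-- `L/2 + 1 → ∞`. [folklore] -/
private theorem tendsto_div_two_succ : Tendsto (fun L : ℕ => L / 2 + 1) atTop atTop :=
  tendsto_atTop_atTop.2 fun b => ⟨2 * b, fun L hL => by omega⟩

/-! ### Face (Y3′) -/

/-- **Face (Y3′) `StripELimZeroY`** of door R96′ «HEX-YC-DCS» (a-idea-1 gen 17 `Sketch_G17.lean`, verbatim): if the
surface-weighted bridge generating functions `B_{T,L}(x_c, y)` are bounded in `L`, then the surface-weighted exit
generating function `E_{T,L}(x_c, y)` tends to `0` as `L → ∞`.
[cite: BeatonBousquetMelouDeGierDuminilCopinGuttmann2014, Proposition 9 and its proof (§4.3, arXiv v5 p. 14: "its remainder of order L tends to 0 as L grows. This remainder is an upper bound on E_{T,L}(x_c,y)")] -/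
def StripELimZeroY : Prop :=
  ∀ (T : ℕ) (y K : ℝ), 1 ≤ T → 0 < y → (∀ L : ℕ, stripGFy T L (IsBetaDart T) y ≤ K) →
    Tendsto (fun L : ℕ => stripGFy T L (IsEpsDart L) y) atTop (𝓝 0)

/-- **(Y3′) holds.** Proof (lane-native, as printed): split `E`-walks at their last surface contact; contact-free
walks and post-contact suffixes are self-avoiding walks of the strip `S_{T-1}` of length `≥ L/2` or follow a bridge of
length `≥ L/2`, the strip `S_{T-1}` is sub-critical at `x_c` (`μ(S_{T-1}) < μ(ℍ) = 1/x_c`, doors HEX-STRIP-STRICT and the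
brick-wall dictionary), and the bridge series converges by hypothesis; so `E_{T,L}(y)` is bounded by tails of two
convergent series. [cite: BeatonBousquetMelouDeGierDuminilCopinGuttmann2014, proof of Proposition 9 (§4.3, arXiv v5 p. 14)] -/
theorem stripELimZeroY_holds : StripELimZeroY := by
  intro T y K hT hy hK
  have hy' := hy.le
  have hK0 : 0 ≤ K := (hK 0).trans' (sum_nonneg fun P _ =>
    mul_nonneg (pow_nonneg hexCriticalFugacity_pos_lt_one.1.le _) (pow_nonneg hy' _))
  have hscx := summable_cx T
  have hsbb := summable_bb hT hy' hK
  -- the majorant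
  set g : ℕ → ℝ := fun L =>
    (∑' k, cx T k - ∑ k ∈ Finset.range L, cx T k) +
      ((∑' m, bb T y m - ∑ m ∈ Finset.range (L / 2 + 1), bb T y m) * ∑' k, cx T k +
        K * (∑' k, cx T k - ∑ k ∈ Finset.range (L / 2), cx T k)) with hg
  have hg0 : Tendsto g atTop (𝓝 0) := by
    have h1 := tendsto_tsum_sub_sum_range hscx tendsto_id
    have h2 := tendsto_tsum_sub_sum_range hsbb tendsto_div_two_succ
    have h3 := tendsto_tsum_sub_sum_range hscx tendsto_div_two
    have := h1.add ((h2.mul_const (∑' k, cx T k)).add (h3.const_mul K))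
    simpa [hg] using this
  refine squeeze_zero (fun L => sum_nonneg fun P _ =>
    mul_nonneg (pow_nonneg hexCriticalFugacity_pos_lt_one.1.le _) (pow_nonneg hy' _)) (fun L => ?_) hg0
  -- `E_{T,L}(y) ≤ g L`
  refine (stripGFy_eps_le hT hy').trans ?_
  rw [hg]
  have hBall : ∑ p ∈ bridgeLists T L, bwt T y p ≤ K := by
    have := hK L; rwa [stripGFy_beta_eq_sum_bridgeLists hT] at this
  have hSall : ∑ k ∈ Finset.range ((stripV T L).card + 1), cx T k ≤ ∑' k, cx T k :=
    hscx.sum_le_tsum _ fun _ _ => cx_nonneg _ _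
  refine add_le_add (sum_range_filter_le_tsum_sub (cx_nonneg T) hscx _ _) (add_le_add ?_ ?_)
  · exact mul_le_mul (sum_filter_bridge_le hT hy' hK L _) hSall (sum_nonneg fun k _ => cx_nonneg T k)
      ((sum_nonneg fun p _ => bwt_nonneg T hy' p).trans (sum_filter_bridge_le hT hy' hK L _))
  · exact mul_le_mul hBall (sum_range_filter_le_tsum_sub (cx_nonneg T) hscx _ _)
      (sum_nonneg fun k _ => cx_nonneg T k) hK0

end Literature.Probability.RandomPlanarGeometry.SAW.HV
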